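import Summits.QuantumFields.YangMills.Theorems.F4SubCurvatureDoorShortRootRigidityHermitianRungsByName
import Summits.QuantumFields.YangMills.Theorems.F4SubCurvatureDoorShortRootRigidityHermitianAngularContinuation
import Summits.QuantumFields.YangMills.Theorems.F4SubCurvatureDoorShortRootRigidityHermitianBoostPositivity
import Mathlib
import HarnessLib

/-!
# Rungs R2 «HERMITIAN ANGULAR CONTINUATION», R4 «BOOST-POSITIVITY KILL» and the heart H2 «HERMITIAN PLANAR RIGIDITY» of SUB-LINE g22-A
# «HERMITIAN SLICE», BY NAME (planner ym-idea-3 g22/g23; crux ⟨stmt-QuantumFields-23035⟩ `F4SubCurvatureDoor.ShortRootRigidity` — CLOSED·proved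
# 2026-08-29T16:36Z by the LEAD's TorusReduction chain ✓p732896; this file is RECORD-only insurance bookkeeping)

Free-hands work of width seat `ym-line-sfw-p2-w3` (g39, cell `ym-idea-1`).  Bookkeeping only: the CONTENT is in
✓`…HermitianAngularContinuation` (`hermitianAngular_unfolded`, p732719) and ✓`…HermitianBoostPositivity` (`boostPositivityKill_unfolded`,
p733262); the rung Props `HermitianAngularRung`, `BoostPositivityKill`, `HermitianPlanarRigidity` (character-identical with the typed rungs file
`Cruxes/ShortRootRigidity/Lines/hermitian_slice_rungs.lean` fdd8f4dcefd5) and the reduced composition `hermitianPlanarRigidity_of_R2_R4` (w4 g25,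
✓p733330, with R1 ✓p732292 and R3 ✓p731762 discharged) are in ✓`…HermitianSliceRegistered` / ✓`…HermitianRungsByName`.  This file closes R2 and
R4 BY NAME by the bare terms and records **H2 `hermitianPlanarRigidity_holds : HermitianPlanarRigidity`** — every kernel of the Hermitian planar
class (continuous off `0`, bounded off the disc, `D₃`-invariant, complex planar Laplace–Fourier representation by a positive measure, budget
`‖y‖⁶‖k‖ → 0`) is `O(2)`-invariant off `0`.  Of the Hermitian route to `:146` (`oddModeRigidity_of_hermitian : H1 → H2 → H3 → H4 → OddModeRigidity`)
the pieces H2 (this file) and H4 (✓p732998) are now tree theorems; H1/H3 are deliberately left untyped (the crux is closed).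

HONEST LABEL: record pieces of an INSURANCE sub-line of a crux already closed by another chain; nothing of route F4SubCurvatureDoor's remaining
cruxes ⟨22566⟩ ⟨23036⟩ ⟨23037⟩, of rung R2d, or of any summit is proved here; the Yang–Mills mass gap is NOT proved.
-/

noncomputable section

namespace Summit.QuantumFields.YangMills.Theorems.F4SubCurvatureDoorHermitianSliceRegistered

/-- ★ **R2 «HERMITIAN ANGULAR CONTINUATION» BY NAME** (uses the `θ₂`/`θ_hex` invariances, the representation, the aperture and the budget). -/
theorem hermitianAngularRung_holds : HermitianAngularRung :=
  fun k μ hk hμ hap =>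
    Summit.QuantumFields.YangMills.Theorems.F4SubCurvatureDoorHermitianAngular.hermitianAngular_unfolded k μ
      hk.2.2.1 hk.2.2.2.1 hμ.2 hap hk.2.2.2.2.2

/-- ★ **R4 «BOOST-POSITIVITY KILL» BY NAME** (uses only the `θ₂` invariance, the representation, the aperture and the three-mode form). -/
theorem boostPositivityKill_holds : BoostPositivityKill :=
  fun k μ hk hμ hap h3 =>
    Summit.QuantumFields.YangMills.Theorems.F4SubCurvatureDoorHermitianBoost.boostPositivityKill_unfolded k μ hk.2.2.1 hμ.2 hap h3

/-- ★★ **H2 «HERMITIAN PLANAR RIGIDITY» BY NAME**: every kernel of the Hermitian planar class is `O(2)`-invariant off `0`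
(R1 ✓ → R2 ✓ → R3 ✓ → R4 ✓ through `hermitianPlanarRigidity_of_rungs`). -/
theorem hermitianPlanarRigidity_holds : HermitianPlanarRigidity :=
  hermitianPlanarRigidity_of_R2_R4 hermitianAngularRung_holds boostPositivityKill_holds

end Summit.QuantumFields.YangMills.Theorems.F4SubCurvatureDoorHermitianSliceRegistered

end
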